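import Summits.HodgeConjecture.HodgeConjecture.Theses.HeckePrymWeil
import Summits.HodgeConjecture.HodgeConjecture.Theorems.WeilTwelvefoldsSqrtMinus7.Negative.EigenvalueTyping
import Summits.HodgeConjecture.HodgeConjecture.Theorems.HeckePrymWeilWeilTwelvefoldsSqrtMinus7WeilMultiplicityLemmas
import Literature.AlgebraicGeometry.HodgeTheory.WeilClassesCyclicPrymTyping
import Literature.AlgebraicGeometry.HodgeTheory.DiagonalSymmetryStability
import Literature.AlgebraicGeometry.Motives.AbelianVarietyCohomologyExteriorH1
import HarnessLib

/-!
# Crux `WeilTwelvefoldsSqrtMinus7` (stmt-HodgeConjecture-1261), line `amnesic-secant-sheaves-split-fourteenfolds` — stub `stub_weilMultiplicity` (α₁, r6)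

**Weil multiplicities `(n, n)` from the Weil class** (B. Moonen, Yu. Zarhin, *Weil classes on
abelian varieties*, J. reine angew. Math. 496 (1998), Criterion (§2); B. van Geemen, LNM 1594 (1994),
4.9 and Lemma 5.2 (6) with proof), PROVED on the tree's real carriers. For a complex abelian
`2n`-fold `(A, φ)`, `φ ≫ φ = -7`, whose Weil span
`Eig((𝟙+φ)^*, (1+i√7)^{2n}) ⊔ Eig((𝟙+φ)^*, (1-i√7)^{2n}) ⊆ H^{2n}(A(ℂ); ℂ)` contains a NON-ZERO
rational class of Hodge type `(n, n)`, both eigenvalues `± i√7` of `φ^*` on the `(1,0)`-piece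
`H^{1,0} = (M.hodgePQ 1 1 0).comap (M.pullback 1)` of any Hodge model `M` have multiplicity `n`.

Printed proof, as typed here: `H¹ = V₊ ⊕ V₋` (eigenspaces of `φ^*`, each of dimension `2n`),
`H¹ = H^{1,0} ⊕ H^{0,1}` (Hodge decomposition of the model, transported along the bijective
pull-back), both decompositions `φ^*`-stable, hence `V± = V±^{1,0} ⊕ V±^{0,1}`; in a basis of `H¹`
ADAPTED to `V₊ = V₊^{1,0} ⊕ V₊^{0,1}` the class `u₁ ⌣ ⋯ ⌣ u_{2n}` is non-zero (a wedge-basis vector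
of `H^{2n} = ⋀^{2n} H¹`, `Motives.abelianVarietyCohomologyExteriorH1_holds`), lies in the LINE
`Eig((𝟙+φ)^*, (1+i√7)^{2n}) = ⋀^{2n} V₊` (`eigenspace_map_nsmul_id_add_nsmul_eq_pullbackEigenclasses`,
`finrank_pullbackEigenclasses_pow_eq_one`, separation `mixed_eq_plus_iff`) and has Hodge type
`(a, a')`, `a = dim V₊^{1,0}`, `a' = dim V₊^{0,1}` (types add under `⌣`,
`cupPreservesHodgeType_of_exists_deRhamIsoFamily`); likewise `⋀^{2n} V₋` has type `(b, b')`. The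
rational class `c = c₊ + c₋` is real, conjugation swaps the two lines and the types, so
`c₋ = conj c₊ ≠ 0` has the two types `(b, b')` and `(a', a)`, whence `(b, b') = (a', a)`; and
`c ∈ H^{n,n}` with `c₊ ∈ H^{a,a'}`, `c₋ ∈ H^{a',a}` forces `a = n` (the pieces are independent),
so `a = b = n`. `n = 0` is degenerate (`H¹ = 0`). The reality hypothesis `M.IsReal` is not used:
every Hodge model of a smooth projective variety is Hodge symmetric (`HodgeModel.isHodgeSymmetric`).
The Hodge-piece bookkeeping on `complexBetti` (independence, spanning, conjugation, types of iterated
cup products) and the linear algebra (eigenspaces along a stable complementary pair, adapted bases)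
are in the sibling file `…WeilMultiplicityLemmas` (part I of this landing). No named fact is taken.
-/

noncomputable section

set_option linter.dupNamespace false

open CategoryTheory Complex
open Literature.AlgebraicGeometry Literature.AlgebraicGeometry.Motives
  Literature.AlgebraicGeometry.HodgeTheory Literature.AlgebraicTopology.SingularHomology

namespace Summit.HodgeConjecture.HodgeConjecture.Theorems.WeilTwelvefoldsSqrtMinus7.AmnesicSecantSheaves

open Summit.HodgeConjecture.HodgeConjecture.Theorems.WeilTwelvefoldsSqrtMinus7.Negative

/-! ## The Weil line `⋀^{2n} V_μ` and its Hodge type in a fixed model -/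

section WeilLine

variable {A : AbelianVariety ℂ}

/-- **Separation in degree `2n` for the test endomorphism `1·𝟙 + 1·φ`**, `μ = ± i√7`:
`(1 + μ)ᵃ (1 - μ)ᵇ ≠ (1 + μ)²ⁿ` whenever `a + b = 2n`, `b ≥ 1` — the hypothesis of
`eigenspace_map_nsmul_id_add_nsmul_eq_pullbackEigenclasses` in its literal `ℕ`-cast shape; both signs
are the landed `mixed_eq_plus_iff` / `mixed_eq_minus_iff` (`(1-i√7)/(1+i√7)` is no root of unity).
[folklore] -/
theorem separation_one_add_sqrt_minus_seven (n : ℕ) (μ : ℂ)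
    (hμ : μ = Complex.I * (Real.sqrt (7 : ℝ) : ℂ) ∨ μ = -(Complex.I * (Real.sqrt (7 : ℝ) : ℂ))) :
    ∀ a b : ℕ, a + b = 2 * n → 0 < b →
      (((1 : ℕ) : ℂ) + ((1 : ℕ) : ℂ) * μ) ^ a * (((1 : ℕ) : ℂ) - ((1 : ℕ) : ℂ) * μ) ^ b ≠
        (((1 : ℕ) : ℂ) + ((1 : ℕ) : ℂ) * μ) ^ (2 * n) := by
  intro a b hab hb h
  simp only [Nat.cast_one, one_mul] at h
  rcases hμ with rfl | rfl
  · rw [← hab] at h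
    exact (Nat.pos_iff_ne_zero.1 hb) ((mixed_eq_plus_iff a b).1 h)
  · have e₁ : (1 : ℂ) + -(Complex.I * (Real.sqrt (7 : ℝ) : ℂ)) =
        1 - Complex.I * (Real.sqrt (7 : ℝ) : ℂ) := by rw [sub_eq_add_neg]
    have e₂ : (1 : ℂ) - -(Complex.I * (Real.sqrt (7 : ℝ) : ℂ)) =
        1 + Complex.I * (Real.sqrt (7 : ℝ) : ℂ) := by rw [sub_neg_eq_add]
    have hba : b + a = 2 * n := by omega
    rw [e₁, e₂, mul_comm, ← hba] at h
    exact (Nat.pos_iff_ne_zero.1 hb) ((mixed_eq_minus_iff b a).1 h)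

/-- **The Weil line `Eig((𝟙+φ)^*|H²ⁿ, (1+μ)²ⁿ) = ⋀²ⁿ V_μ` has Hodge type `(a, a')`,
`a = dim (V_μ ∩ H^{1,0})`, `a' = dim (V_μ ∩ H^{0,1})`, and `a + a' = 2n`**, for a complex abelian
`2n`-fold `(A, φ)` with `φ ≫ φ = -7`, `μ = ± i√7`, and any Hodge model `M` (van Geemen, proof of
Lemma 5.2 (6): "`⋀²ⁿ W'₊` … has Hodge type `(a, 2n - a)`"; Moonen–Zarhin, Criterion). Proof on the
carriers: `H¹ = H^{1,0} ⊕ H^{0,1}` (Hodge decomposition of `M` transported) and `H¹ = V_μ ⊕ V_{-μ}`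
(`isCompl_eigenspace_eigenspace_neg`) are `φ^*`-stable (`pullback_map_mem_hodgePQ_of_endomorphism`),
so `V_μ = (V_μ ∩ H^{1,0}) ⊕ (V_μ ∩ H^{0,1})` (`eigenspace_eq_inf_sup_inf`), of dimension `2n`
(`two_mul_finrank_eigenspace_eq`, `b₁ = 4n`); for a basis `b` of `H¹` adapted to this splitting
(`exists_basis_adapted`) the class `c₁ = b₁ ⌣ ⋯ ⌣ b_{2n}` is a wedge-basis vector of
`H²ⁿ = ⋀²ⁿ H¹` (`abelianVarietyCohomologyExteriorH1_holds`), hence non-zero, it has type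
`(a, a')` (`cupPowOne_mem_comap_hodgePQ`), and it lies in the eigenspace, which is a LINE
(`eigenspace_map_nsmul_id_add_nsmul_eq_pullbackEigenclasses`, `finrank_pullbackEigenclasses_pow_eq_one`,
separation `separation_one_add_sqrt_minus_seven`), hence is `ℂ c₁`.
[cite: vanGeemen1994HodgeAV, 4.9 and proof of Lemma 5.2 (6)] [cite: MoonenZarhin1998WeilClasses, Criterion (§2)] -/
theorem eigenspace_one_add_le_comap_hodgePQ {n : ℕ} (hA : A.dim = 2 * n) {φ : A ⟶ A}
    (hφ : φ ≫ φ = -(7 • 𝟙 A)) {μ : ℂ}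
    (hμ : μ = Complex.I * (Real.sqrt (7 : ℝ) : ℂ) ∨ μ = -(Complex.I * (Real.sqrt (7 : ℝ) : ℂ)))
    (M : HodgeModel (2 * n) A.X) :
    Module.finrank ℂ ↥(Module.End.eigenspace (complexBetti.map φ.hom.hom.hom 1).hom μ ⊓
        (M.hodgePQ 1 1 0).comap (M.pullback 1).hom) +
      Module.finrank ℂ ↥(Module.End.eigenspace (complexBetti.map φ.hom.hom.hom 1).hom μ ⊓
        (M.hodgePQ 1 0 1).comap (M.pullback 1).hom) = 2 * n ∧
    Module.End.eigenspace (complexBetti.map (𝟙 A + φ).hom.hom.hom (2 * n)).hom ((1 + μ) ^ (2 * n)) ≤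
      (M.hodgePQ (2 * n)
        (Module.finrank ℂ ↥(Module.End.eigenspace (complexBetti.map φ.hom.hom.hom 1).hom μ ⊓
          (M.hodgePQ 1 1 0).comap (M.pullback 1).hom))
        (Module.finrank ℂ ↥(Module.End.eigenspace (complexBetti.map φ.hom.hom.hom 1).hom μ ⊓
          (M.hodgePQ 1 0 1).comap (M.pullback 1).hom))).comap (M.pullback (2 * n)).hom := by
  classical
  haveI := finite_complexBetti_abelianVariety A 1
  have hX : IsSmoothProjective (2 * n) A.X := hA ▸ AbelianVariety.isSmoothProjective_holds
  have hΛ := abelianVarietyCohomologyExteriorH1_holds.hasExteriorCohomologyH1 A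
  have hb₁ : Module.finrank ℂ (complexBetti A.X 1) = 2 * (2 * n) := by
    rw [AbelianVariety.finrank_complexBetti_one, hA]
  have hd : (0 : ℕ) < 7 := by norm_num
  set T := (complexBetti.map φ.hom.hom.hom 1).hom with hT
  set H10 := (M.hodgePQ 1 1 0).comap (M.pullback 1).hom with hH10
  set H01 := (M.hodgePQ 1 0 1).comap (M.pullback 1).hom with hH01
  set a := Module.finrank ℂ ↥(Module.End.eigenspace T μ ⊓ H10) with ha
  set a' := Module.finrank ℂ ↥(Module.End.eigenspace T μ ⊓ H01) with ha'
  -- `H¹ = H^{1,0} ⊕ H^{0,1}`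
  have h1 : IsCompl H10 H01 := by
    have hind := iSupIndep_comap_hodgePQ M 1
    have htop := iSup_comap_hodgePQ_eq_top M 1
    let i₁ : ↥(Finset.HasAntidiagonal.antidiagonal 1) := ⟨(1, 0), Finset.HasAntidiagonal.mem_antidiagonal.2 rfl⟩
    let i₀ : ↥(Finset.HasAntidiagonal.antidiagonal 1) := ⟨(0, 1), Finset.HasAntidiagonal.mem_antidiagonal.2 rfl⟩
    have hne : i₁ ≠ i₀ := fun h ↦
      one_ne_zero (congrArg (fun i : ↥(Finset.HasAntidiagonal.antidiagonal 1) ↦ i.1.1) h)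
    have hdisj : Disjoint H10 H01 := by
      have hd := hind.pairwiseDisjoint hne
      rw [Function.onFun, Submodule.disjoint_def] at hd
      exact Submodule.disjoint_def.2 fun x hx hx' ↦ hd x hx hx'
    refine ⟨hdisj, codisjoint_iff.2 (top_le_iff.1 ?_)⟩
    rw [← htop]
    refine iSup_le fun pq ↦ ?_
    obtain ⟨⟨x, y⟩, hxy⟩ := pq
    have hxy' : x + y = 1 := Finset.HasAntidiagonal.mem_antidiagonal.1 hxy
    rcases Nat.eq_zero_or_pos x with rfl | hx
    · obtain rfl : y = 1 := by omega
      exact le_sup_right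
    · obtain rfl : x = 1 := by omega
      obtain rfl : y = 0 := by omega
      exact le_sup_left
  -- `φ^*`-stability of the pieces
  have hstab : ∀ p q : ℕ, ∀ v ∈ (M.hodgePQ 1 p q).comap (M.pullback 1).hom,
      T v ∈ (M.hodgePQ 1 p q).comap (M.pullback 1).hom :=
    fun p q v hv ↦ M.pullback_map_mem_hodgePQ_of_endomorphism hX φ.hom.hom.hom hv
  -- `H¹ = V_μ ⊕ V_{-μ}`, `dim V_μ = 2n`
  have hcompl : IsCompl (Module.End.eigenspace T μ) (Module.End.eigenspace T (-μ)) := by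
    rcases hμ with rfl | rfl
    · exact isCompl_eigenspace_eigenspace_neg hd hφ
    · rw [neg_neg]; exact (isCompl_eigenspace_eigenspace_neg hd hφ).symm
  have hp : Module.finrank ℂ ↥(Module.End.eigenspace T μ) = 2 * n := by
    have hps : Module.finrank ℂ ↥(Module.End.eigenspace T (Complex.I * (Real.sqrt (7 : ℝ) : ℂ))) = 2 * n := by
      have h := two_mul_finrank_eigenspace_eq hd hφ
      rw [hb₁] at h
      change 2 * Module.finrank ℂ ↥(Module.End.eigenspace T (Complex.I * (Real.sqrt (7 : ℝ) : ℂ))) =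
        2 * (2 * n) at h
      omega
    rcases hμ with rfl | rfl
    · exact hps
    · have h := finrank_eigenspace_eq_finrank_eigenspace_neg hd hφ
      change Module.finrank ℂ ↥(Module.End.eigenspace T (Complex.I * (Real.sqrt (7 : ℝ) : ℂ))) =
        Module.finrank ℂ ↥(Module.End.eigenspace T (-(Complex.I * (Real.sqrt (7 : ℝ) : ℂ)))) at h
      rw [← h, hps]
  -- `V_μ = (V_μ ∩ H^{1,0}) ⊕ (V_μ ∩ H^{0,1})`, `a + a' = 2n`
  have hsplit := eigenspace_eq_inf_sup_inf T h1 (hstab 1 0) (hstab 0 1) μ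
  have hsum : a + a' = 2 * n := by
    rw [← hp]; exact (finrank_eigenspace_eq_add T h1 (hstab 1 0) (hstab 0 1) μ).symm
  refine ⟨hsum, ?_⟩
  -- an adapted basis and the class `c₁ = b₁ ⌣ ⋯ ⌣ b_{2n}`
  obtain ⟨r, b, p, q, hbE, hbPQ, hp1, hq1⟩ := exists_basis_adapted hcompl hsplit h1.disjoint hsum
  set w : Fin (2 * n) → complexBetti A.X 1 := fun i ↦ b (Fin.castAdd r i) with hw
  set c₁ := cupPowOne ℂ (ComplexPoints A.X) (2 * n) w with hc₁
  -- Hodge type `(a, a')`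
  have htype : c₁ ∈ (M.hodgePQ (2 * n) a a').comap (M.pullback (2 * n)).hom := by
    have h := cupPowOne_mem_comap_hodgePQ (2 * n) A.X M hX (2 * n) w p q fun i ↦ by
      rcases hbPQ i with ⟨hp, hq, hmem⟩ | ⟨hp, hq, hmem⟩
      · rw [hp, hq]; exact hmem
      · rw [hp, hq]; exact hmem
    rwa [hp1, hq1] at h
  -- `c₁ ≠ 0`: a wedge-basis vector of `H²ⁿ = ⋀²ⁿ H¹`
  have h0 : c₁ ≠ 0 := by
    let Bw : Module.Basis (Set.powersetCard (Fin (2 * n + r)) (2 * n)) ℂ (complexBetti A.X (2 * n)) :=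
      (b.exteriorPower (2 * n)).map (hΛ.equiv (2 * n))
    let S₀ : Set.powersetCard (Fin (2 * n + r)) (2 * n) :=
      Set.powersetCard.ofFinEmbEquiv (Fin.castAddOrderEmb r)
    have hS : Bw S₀ = c₁ := by
      change hΛ.equiv (2 * n) ((b.exteriorPower (2 * n)) S₀) = _
      rw [exteriorPower.basis_apply, HasExteriorCohomologyH1.equiv_apply, exteriorPower.ιMulti_family,
        wedgeToCup_ιMulti, Equiv.symm_apply_apply]
      congr 1
    rw [← hS]
    exact Bw.ne_zero S₀
  -- `c₁ ∈ Eig((𝟙+φ)^*, (1+μ)²ⁿ)`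
  have hwμ : ∀ i, w i ∈ Module.End.eigenspace T μ := fun i ↦ hbE i
  have hmem : c₁ ∈ Module.End.eigenspace (complexBetti.map (𝟙 A + φ).hom.hom.hom (2 * n)).hom
      ((1 + μ) ^ (2 * n)) := by
    rw [Module.End.mem_eigenspace_iff]
    change singularCohomology.map ℂ ℂ (AlgPoints.mapContinuous (L := ℂ) (𝟙 A + φ).hom.hom.hom) (2 * n)
      (cupPowOne ℂ _ (2 * n) w) = _
    rw [map_cupPowOne]
    have e : (fun i ↦ singularCohomology.map ℂ ℂ (AlgPoints.mapContinuous (L := ℂ) (𝟙 A + φ).hom.hom.hom) 1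
        (w i)) = fun i ↦ (1 + μ) • w i := by
      funext i
      have h := complexBetti_map_nsmul_id_add_nsmul_one_of_mem_eigenspace (hwμ i) 1 1
      rw [one_smul, one_smul, Nat.cast_one, one_mul] at h
      exact h
    rw [e, MultilinearMap.map_smul_univ, Finset.prod_const, Finset.card_univ, Fintype.card_fin]
  -- the eigenspace is the line `ℂ c₁`
  have hline : Module.End.eigenspace (complexBetti.map (𝟙 A + φ).hom.hom.hom (2 * n)).hom
      ((1 + μ) ^ (2 * n)) ≤ ℂ ∙ c₁ := by
    have hid := eigenspace_map_nsmul_id_add_nsmul_eq_pullbackEigenclasses hΛ (n := n) (d := 7) hd hφ hμ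
      1 1 (separation_one_add_sqrt_minus_seven n μ hμ)
    have hop : (𝟙 A + φ : A ⟶ A) = (1 : ℕ) • 𝟙 A + (1 : ℕ) • φ := by rw [one_smul, one_smul]
    have hval : (1 + μ) ^ (2 * n) = (((1 : ℕ) : ℂ) + ((1 : ℕ) : ℂ) * μ) ^ (2 * n) := by
      rw [Nat.cast_one, one_mul]
    have hfin : Module.finrank ℂ
        ↥(pullbackEigenclasses A φ (2 * n) fun x y ↦ ((x : ℂ) + (y : ℂ) * μ) ^ (2 * n)) = 1 :=
      finrank_pullbackEigenclasses_pow_eq_one hΛ hb₁ hd hφ hμ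
    have hmem' : c₁ ∈ pullbackEigenclasses A φ (2 * n) fun x y ↦ ((x : ℂ) + (y : ℂ) * μ) ^ (2 * n) := by
      rw [← hid, ← hop, ← hval]; exact hmem
    haveI : FiniteDimensional ℂ
        ↥(pullbackEigenclasses A φ (2 * n) fun x y ↦ ((x : ℂ) + (y : ℂ) * μ) ^ (2 * n)) :=
      Module.finite_of_finrank_eq_succ hfin
    rw [hop, hval, hid]
    intro c hc
    obtain ⟨t, ht⟩ := (finrank_eq_one_iff_of_nonzero'
      (⟨c₁, hmem'⟩ : ↥(pullbackEigenclasses A φ (2 * n) fun x y ↦ ((x : ℂ) + (y : ℂ) * μ) ^ (2 * n)))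
      (by simpa using h0)).1 hfin ⟨c, hc⟩
    refine Submodule.mem_span_singleton.2 ⟨t, ?_⟩
    simpa using congrArg Subtype.val ht
  exact hline.trans ((Submodule.span_singleton_le_iff_mem _ _).2 htype)

/-- **Conjugation twists the eigenvalue of a pull-back eigenclass**: if `f^* c = λ c` on
`Hᵏ(A(ℂ); ℂ)` then `f^* c̄ = conj(λ) c̄` (conjugation of cochain values commutes with pull-backs and
is conjugate-linear, `conjClass_map`, `conjClass_smul`). [cite: VoisinHodgeI2002, Cor. 6.12] -/
theorem conjClass_mem_eigenspace_map (f : A ⟶ A) {k : ℕ} {t : ℂ} {c : complexBetti A.X k}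
    (hc : c ∈ Module.End.eigenspace (complexBetti.map f.hom.hom.hom k).hom t) :
    conjClass (ComplexPoints A.X) k c ∈
      Module.End.eigenspace (complexBetti.map f.hom.hom.hom k).hom (starRingEnd ℂ t) := by
  rw [Module.End.mem_eigenspace_iff] at hc ⊢
  change singularCohomology.map ℂ ℂ (AlgPoints.mapContinuous (L := ℂ) f.hom.hom.hom) k
    (conjClass (ComplexPoints A.X) k c) = _
  rw [← conjClass_map, ← conjClass_smul]
  exact congrArg _ hc

/-- `conj ((1 + i√7)ᵐ) = (1 - i√7)ᵐ`. [folklore] -/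
theorem starRingEnd_one_add_I_sqrt7_pow (m : ℕ) :
    starRingEnd ℂ ((1 + Complex.I * (Real.sqrt (7 : ℝ) : ℂ)) ^ m) =
      (1 - Complex.I * (Real.sqrt (7 : ℝ) : ℂ)) ^ m := by
  rw [map_pow, map_add, map_one, map_mul, Complex.conj_I, Complex.conj_ofReal, neg_mul, sub_eq_add_neg]

/-- `conj ((1 - i√7)ᵐ) = (1 + i√7)ᵐ`. [folklore] -/
theorem starRingEnd_one_sub_I_sqrt7_pow (m : ℕ) :
    starRingEnd ℂ ((1 - Complex.I * (Real.sqrt (7 : ℝ) : ℂ)) ^ m) =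
      (1 + Complex.I * (Real.sqrt (7 : ℝ) : ℂ)) ^ m := by
  rw [map_pow, map_sub, map_one, map_mul, Complex.conj_I, Complex.conj_ofReal, neg_mul, sub_neg_eq_add]

end WeilLine

/-! ## The stub -/

/-- **Stub α₁ (r6) — Weil multiplicities from the Weil class.** For a complex abelian `2n`-fold
`(A, φ)`, `φ ≫ φ = -7`, carrying a NON-ZERO rational `(n,n)`-class in its Weil span
`Eig((𝟙+φ)^*, (1+i√7)^{2n}) ⊔ Eig((𝟙+φ)^*, (1-i√7)^{2n}) ⊆ H^{2n}`, the eigenvalues `± i√7` of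
`φ^*` on `H^{1,0}(A)` (the `(1,0)`-piece of any Hodge model) both have multiplicity `n`
(Moonen–Zarhin, Criterion; van Geemen 4.9, Lemma 5.2 (6)). Proof: the two Weil lines have types
`(a, a')`, `(b, b')` with `a + a' = 2n` (`eigenspace_one_add_le_comap_hodgePQ`); the rational class
`c = c₊ + c₋ ≠ 0` is real (`IsRationalClass.conjClass_eq`) and conjugation swaps the two lines
(`conjClass_mem_eigenspace_map`), which meet in `0` for `n ≥ 1` (`one_add_I_sqrt7_pow_ne`), so
`c₋ = conj c₊ ≠ 0` has types `(b, b')` and `(a', a)` (`conjClass_mem_comap_hodgePQ`), whence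
`(b, b') = (a', a)` (`hodgeType_unique_of_ne_zero`); `c ∈ H^{n,n}` then forces `a = n`
(`eq_zero_of_mem_of_eq_add`), so `a = b = n`. For `n = 0`, `H¹ = 0`. The hypothesis `M.IsReal` is
not needed. [cite: MoonenZarhin1998WeilClasses, Criterion (§2)]
[cite: vanGeemen1994HodgeAV, 4.9 and Lemma 5.2 (6) with proof] -/
theorem stub_weilMultiplicity :
    ∀ (n : ℕ) (A : AbelianVariety ℂ) (φ : A ⟶ A), A.dim = 2 * n → φ ≫ φ = -((7 : ℤ) • 𝟙 A) →
      (∃ c : complexBetti A.X (2 * n), c ≠ 0 ∧ IsRationalClass c ∧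
        IsOfHodgeType (2 * n) A.X (2 * n) n n c ∧
        c ∈ Module.End.eigenspace (complexBetti.map (𝟙 A + φ).hom.hom.hom (2 * n)).hom
              ((1 + Complex.I * (Real.sqrt (7 : ℝ) : ℂ)) ^ (2 * n)) ⊔
            Module.End.eigenspace (complexBetti.map (𝟙 A + φ).hom.hom.hom (2 * n)).hom
              ((1 - Complex.I * (Real.sqrt (7 : ℝ) : ℂ)) ^ (2 * n))) →
    ∀ (M : HodgeModel (2 * n) A.X), M.IsReal →
      Module.finrank ℂ ↥(Module.End.eigenspace (complexBetti.map φ.hom.hom.hom 1).hom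
            (Complex.I * (Real.sqrt (7 : ℝ) : ℂ)) ⊓ (M.hodgePQ 1 1 0).comap (M.pullback 1).hom) = n ∧
      Module.finrank ℂ ↥(Module.End.eigenspace (complexBetti.map φ.hom.hom.hom 1).hom
            (-(Complex.I * (Real.sqrt (7 : ℝ) : ℂ))) ⊓ (M.hodgePQ 1 1 0).comap (M.pullback 1).hom) = n := by
  intro n A φ hA hφ hc M _
  haveI := finite_complexBetti_abelianVariety A 1
  have hφ' : φ ≫ φ = -((7 : ℕ) • 𝟙 A) := by rw [hφ, ← natCast_zsmul]; rfl
  rcases Nat.eq_zero_or_pos n with rfl | hn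
  · -- `n = 0`: `H¹ = 0`
    have h0 : Module.finrank ℂ (complexBetti A.X 1) = 0 := by
      rw [AbelianVariety.finrank_complexBetti_one, hA]
    constructor <;> exact Nat.eq_zero_of_le_zero ((Submodule.finrank_le _).trans h0.le)
  have hX : IsSmoothProjective (2 * n) A.X := hA ▸ AbelianVariety.isSmoothProjective_holds
  set s : ℂ := Complex.I * (Real.sqrt (7 : ℝ) : ℂ) with hs
  set T := (complexBetti.map φ.hom.hom.hom 1).hom with hT
  set T₂ := (complexBetti.map (𝟙 A + φ).hom.hom.hom (2 * n)).hom with hT₂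
  set H10 := (M.hodgePQ 1 1 0).comap (M.pullback 1).hom with hH10
  set H01 := (M.hodgePQ 1 0 1).comap (M.pullback 1).hom with hH01
  set a := Module.finrank ℂ ↥(Module.End.eigenspace T s ⊓ H10) with ha
  set a' := Module.finrank ℂ ↥(Module.End.eigenspace T s ⊓ H01) with ha'
  set b := Module.finrank ℂ ↥(Module.End.eigenspace T (-s) ⊓ H10) with hb
  set b' := Module.finrank ℂ ↥(Module.End.eigenspace T (-s) ⊓ H01) with hb'
  -- the two Weil lines and their types
  obtain ⟨hsum, hplus⟩ := eigenspace_one_add_le_comap_hodgePQ hA hφ' (μ := s) (Or.inl rfl) M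
  obtain ⟨hsum', hminus⟩ := eigenspace_one_add_le_comap_hodgePQ hA hφ' (μ := -s) (Or.inr rfl) M
  have em : (1 : ℂ) + -s = 1 - s := by rw [sub_eq_add_neg]
  rw [em] at hminus
  change a + a' = 2 * n at hsum
  change b + b' = 2 * n at hsum'
  change Module.End.eigenspace T₂ ((1 + s) ^ (2 * n)) ≤
    (M.hodgePQ (2 * n) a a').comap (M.pullback (2 * n)).hom at hplus
  change Module.End.eigenspace T₂ ((1 - s) ^ (2 * n)) ≤
    (M.hodgePQ (2 * n) b b').comap (M.pullback (2 * n)).hom at hminus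
  -- the Weil class
  obtain ⟨c, hc0, hcrat, hctype, hcmem⟩ := hc
  change c ∈ Module.End.eigenspace T₂ ((1 + s) ^ (2 * n)) ⊔ Module.End.eigenspace T₂ ((1 - s) ^ (2 * n))
    at hcmem
  obtain ⟨cp, hcp, cm, hcm, hcpm⟩ := Submodule.mem_sup.1 hcmem
  have hcn : c ∈ (M.hodgePQ (2 * n) n n).comap (M.pullback (2 * n)).hom :=
    (isOfHodgeType_iff_mem_hodgePQ hX M c).1 hctype
  -- conjugation swaps the two lines; they meet in `0`
  have hcp' : conjClass (ComplexPoints A.X) (2 * n) cp ∈ Module.End.eigenspace T₂ ((1 - s) ^ (2 * n)) := by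
    have h := conjClass_mem_eigenspace_map (𝟙 A + φ) hcp
    rwa [starRingEnd_one_add_I_sqrt7_pow] at h
  have hcm' : conjClass (ComplexPoints A.X) (2 * n) cm ∈ Module.End.eigenspace T₂ ((1 + s) ^ (2 * n)) := by
    have h := conjClass_mem_eigenspace_map (𝟙 A + φ) hcm
    rwa [starRingEnd_one_sub_I_sqrt7_pow] at h
  have hdisj : Disjoint (Module.End.eigenspace T₂ ((1 + s) ^ (2 * n)))
      (Module.End.eigenspace T₂ ((1 - s) ^ (2 * n))) :=
    (Module.End.eigenspaces_iSupIndep T₂).pairwiseDisjoint (one_add_I_sqrt7_pow_ne (2 * n) (by omega))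
  have hreal : conjClass (ComplexPoints A.X) (2 * n) c = c := hcrat.conjClass_eq
  have hcm_eq : cm = conjClass (ComplexPoints A.X) (2 * n) cp := by
    -- `cp - conj cm = conj cp - cm ∈ E₊ ∩ E₋ = 0`
    have e : cp - conjClass (ComplexPoints A.X) (2 * n) cm = conjClass (ComplexPoints A.X) (2 * n) cp - cm := by
      have h2 : conjClass (ComplexPoints A.X) (2 * n) cp + conjClass (ComplexPoints A.X) (2 * n) cm = cp + cm := by
        rw [← conjClass_add, hcpm, hreal]
      calc cp - conjClass (ComplexPoints A.X) (2 * n) cm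
          = (cp + cm) - (conjClass (ComplexPoints A.X) (2 * n) cm + cm) := by abel
        _ = (conjClass (ComplexPoints A.X) (2 * n) cp + conjClass (ComplexPoints A.X) (2 * n) cm) -
              (conjClass (ComplexPoints A.X) (2 * n) cm + cm) := by rw [h2]
        _ = conjClass (ComplexPoints A.X) (2 * n) cp - cm := by abel
    have hinp : cp - conjClass (ComplexPoints A.X) (2 * n) cm ∈ Module.End.eigenspace T₂ ((1 + s) ^ (2 * n)) :=
      Submodule.sub_mem _ hcp hcm'
    have hinm : cp - conjClass (ComplexPoints A.X) (2 * n) cm ∈ Module.End.eigenspace T₂ ((1 - s) ^ (2 * n)) := by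
      rw [e]; exact Submodule.sub_mem _ hcp' hcm
    have hz : cp - conjClass (ComplexPoints A.X) (2 * n) cm = 0 := (Submodule.disjoint_def.1 hdisj) _ hinp hinm
    rw [hz, eq_comm, sub_eq_zero] at e
    exact e.symm
  have hcm0 : cm ≠ 0 := by
    intro h
    have hcp0 : cp = 0 := by
      have h' := congrArg (conjClass (ComplexPoints A.X) (2 * n)) hcm_eq
      rw [conjClass_conjClass, h, conjClass_zero] at h'
      exact h'.symm
    exact hc0 (by rw [← hcpm, hcp0, h, add_zero])
  -- `c₋` has the two types `(b, b')` and `(a', a)`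
  have hcm₁ : cm ∈ (M.hodgePQ (2 * n) b b').comap (M.pullback (2 * n)).hom := hminus hcm
  have hcm₂ : cm ∈ (M.hodgePQ (2 * n) a' a).comap (M.pullback (2 * n)).hom := by
    rw [hcm_eq]; exact conjClass_mem_comap_hodgePQ M hX (hplus hcp)
  have hba : (b, b') = (a', a) := hodgeType_unique_of_ne_zero M hcm₁ hcm₂ hcm0
  have hb_eq : b = a' := congrArg Prod.fst hba
  -- `c ∈ H^{n,n}` forces `a = n`
  have han : a = n := by
    by_contra hne
    have hne' : a' ≠ n := by omega
    refine hc0 (eq_zero_of_mem_of_eq_add M hcn (hplus hcp) hcm₂ hcpm.symm ?_ ?_ (by omega))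
    · exact fun h ↦ hne (congrArg Prod.fst h)
    · exact fun h ↦ hne' (congrArg Prod.fst h)
  exact ⟨han, by omega⟩

end Summit.HodgeConjecture.HodgeConjecture.Theorems.WeilTwelvefoldsSqrtMinus7.AmnesicSecantSheaves

end
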